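import Summits.Ventures.PercRepro.C041ThreeExitSix

/-!
# ROW C-041 — THE THREE-EXIT BLOCK MAP, part A: the fibre vector is the contribution of the statuses when the
first exit is merged (p6, gen 31)

Setting of `C041ThreeExitSix`: the five status patterns with `u` merged (`fibVec3_eq_merged`), through the
counting lemmas of `C041ThreeExitCount`; the patterns with `u` separated and THEOREM (THREE-EXIT BLOCK MAP) are in
`C041ThreeExitMain`.
-/

namespace PercRepro

namespace ZoneZ

namespace TwoExit

open ZoneData TreeClosure Finset

variable {V₁ E₁ U₁ U₂ V E T₁ T₂ V' E' T₁' T₂' V'' E'' T₁'' T₂'' : Type}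
variable (Z₁ : ZoneData V₁ E₁ U₁ U₂) (u u' u'' : V₁) (Z : ZoneData V E T₁ T₂) (a : V)
  (Z' : ZoneData V' E' T₁' T₂') (a' : V') (Z'' : ZoneData V'' E'' T₁'' T₂'') (a'' : V'') (a₁ : V₁)
variable [Fintype E₁] [DecidableEq E₁] [Fintype E] [DecidableEq E] [Fintype T₁] [DecidableEq T₁]
  [Fintype T₂] [DecidableEq T₂] [Fintype E'] [DecidableEq E'] [Fintype T₁'] [DecidableEq T₁']
  [Fintype T₂'] [DecidableEq T₂'] [Fintype E''] [DecidableEq E''] [Fintype T₁''] [DecidableEq T₁'']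
  [Fintype T₂''] [DecidableEq T₂'']

omit [Fintype E₁] [DecidableEq E₁] in
/-- The fibre vector is the contribution of the statuses: the first exit merged. -/
theorem fibVec3_eq_merged (ω : E₁ → Bool) (hm : Z₁.Mg a₁ u ω) :
    fibVec3 Z₁ u u' u'' Z a Z' a' Z'' a'' a₁ ω = contrib3 (Z.sixVec a) (Z'.sixVec a') (Z''.sixVec a'') (Z₁.Mg a₁ u ω) (Z₁.Rd a₁ u ω) (Z₁.Mg a₁ u' ω) (Z₁.Rd a₁ u' ω) (Z₁.Mg a₁ u'' ω) (Z₁.Rd a₁ u'' ω) (Z₁.Mg u u' ω) (Z₁.Mg u'' u' ω) (Z₁.Mg u'' u ω) := by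
  unfold contrib3
  rw [exitOf_sixVec, exitOf_sixVec, exitOf_sixVec]
  rw [if_pos hm]
  by_cases hm' : Z₁.Mg a₁ u' ω
  · rw [if_pos hm']
    by_cases hm'' : Z₁.Mg a₁ u'' ω
    · rw [if_pos hm'']
      refine vec6_ext _ _ ?_ ?_ ?_ ?_ ?_ ?_
      · simp only [fibVec3, exitVec, Pi.mul_apply, Matrix.cons_val]
        rw [card_fib3_mmm Z₁ u u' u'' Z a Z' a' Z'' a'' a₁ ω hm hm' hm'' true true false (Or.inl rfl)]
        push_cast
        ring
      · simp only [fibVec3, exitVec, Pi.mul_apply, Matrix.cons_val]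
        rw [card_fib3_mmm Z₁ u u' u'' Z a Z' a' Z'' a'' a₁ ω hm hm' hm'' false true false (Or.inr rfl)]
        push_cast
        ring
      · simp only [fibVec3, exitVec, Pi.mul_apply, Matrix.cons_val]
        rw [card_fib3_mmm Z₁ u u' u'' Z a Z' a' Z'' a'' a₁ ω hm hm' hm'' true false false (Or.inl rfl)]
        push_cast
        ring
      · simp only [fibVec3, exitVec, Pi.mul_apply, Matrix.cons_val]
        rw [card_fib3_mmm Z₁ u u' u'' Z a Z' a' Z'' a'' a₁ ω hm hm' hm'' true true true (Or.inl rfl)]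
        push_cast
        ring
      · simp only [fibVec3, exitVec, Pi.mul_apply, Matrix.cons_val]
        rw [card_fib3_mmm Z₁ u u' u'' Z a Z' a' Z'' a'' a₁ ω hm hm' hm'' false true true (Or.inr rfl)]
        push_cast
        ring
      · simp only [fibVec3, exitVec, Pi.mul_apply, Matrix.cons_val]
        rw [card_fib3_mmm Z₁ u u' u'' Z a Z' a' Z'' a'' a₁ ω hm hm' hm'' true false true (Or.inl rfl)]
        push_cast
        ring
    · rw [if_neg hm'']
      simp only [thR_exitVec]
      refine vec6_ext _ _ ?_ ?_ ?_ ?_ ?_ ?_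
      · simp only [fibVec3, exitVec, nVec, Pi.mul_apply, Matrix.cons_val]
        rw [card_fib3_mm_s Z₁ u u' u'' Z a Z' a' Z'' a'' a₁ ω hm hm' hm'' true true false (Or.inl rfl)]
        push_cast
        ring
      · simp only [fibVec3, exitVec, nVec, Pi.mul_apply, Matrix.cons_val]
        rw [card_fib3_mm_s Z₁ u u' u'' Z a Z' a' Z'' a'' a₁ ω hm hm' hm'' false true false (Or.inr rfl)]
        push_cast
        ring
      · simp only [fibVec3, exitVec, nVec, Pi.mul_apply, Matrix.cons_val]
        rw [card_fib3_mm_s Z₁ u u' u'' Z a Z' a' Z'' a'' a₁ ω hm hm' hm'' true false false (Or.inl rfl)]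
        push_cast
        ring
      · simp only [fibVec3, exitVec, nVec, Pi.mul_apply, Matrix.cons_val]
        rw [card_fib3_mm_s Z₁ u u' u'' Z a Z' a' Z'' a'' a₁ ω hm hm' hm'' true true true (Or.inl rfl)]
        push_cast
        ring
      · simp only [fibVec3, exitVec, nVec, Pi.mul_apply, Matrix.cons_val]
        rw [card_fib3_mm_s Z₁ u u' u'' Z a Z' a' Z'' a'' a₁ ω hm hm' hm'' false true true (Or.inr rfl)]
        push_cast
        ring
      · simp only [fibVec3, exitVec, nVec, Pi.mul_apply, Matrix.cons_val]
        rw [card_fib3_mm_s Z₁ u u' u'' Z a Z' a' Z'' a'' a₁ ω hm hm' hm'' true false true (Or.inl rfl)]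
        push_cast
        ring
  · rw [if_neg hm']
    by_cases hm'' : Z₁.Mg a₁ u'' ω
    · rw [if_pos hm'']
      simp only [thR_exitVec]
      refine vec6_ext _ _ ?_ ?_ ?_ ?_ ?_ ?_
      · simp only [fibVec3, exitVec, nVec, Pi.mul_apply, Matrix.cons_val]
        rw [card_fib3_m_s_m Z₁ u u' u'' Z a Z' a' Z'' a'' a₁ ω hm hm' hm'' true true false (Or.inl rfl)]
        push_cast
        ring
      · simp only [fibVec3, exitVec, nVec, Pi.mul_apply, Matrix.cons_val]
        rw [card_fib3_m_s_m Z₁ u u' u'' Z a Z' a' Z'' a'' a₁ ω hm hm' hm'' false true false (Or.inr rfl)]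
        push_cast
        ring
      · simp only [fibVec3, exitVec, nVec, Pi.mul_apply, Matrix.cons_val]
        rw [card_fib3_m_s_m Z₁ u u' u'' Z a Z' a' Z'' a'' a₁ ω hm hm' hm'' true false false (Or.inl rfl)]
        push_cast
        ring
      · simp only [fibVec3, exitVec, nVec, Pi.mul_apply, Matrix.cons_val]
        rw [card_fib3_m_s_m Z₁ u u' u'' Z a Z' a' Z'' a'' a₁ ω hm hm' hm'' true true true (Or.inl rfl)]
        push_cast
        ring
      · simp only [fibVec3, exitVec, nVec, Pi.mul_apply, Matrix.cons_val]
        rw [card_fib3_m_s_m Z₁ u u' u'' Z a Z' a' Z'' a'' a₁ ω hm hm' hm'' false true true (Or.inr rfl)]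
        push_cast
        ring
      · simp only [fibVec3, exitVec, nVec, Pi.mul_apply, Matrix.cons_val]
        rw [card_fib3_m_s_m Z₁ u u' u'' Z a Z' a' Z'' a'' a₁ ω hm hm' hm'' true false true (Or.inl rfl)]
        push_cast
        ring
    · rw [if_neg hm'']
      by_cases hbc' : Z₁.Mg u'' u' ω
      · rw [if_pos hbc']
        refine vec6_ext _ _ ?_ ?_ ?_ ?_ ?_ ?_
        · simp only [fibVec3, exitVec, thR, nAdm, kInv, Pi.mul_apply, Matrix.cons_val]
          have h := card_fib3_m_joint Z₁ u u' u'' Z a Z' a' Z'' a'' a₁ ω hm hm' hm'' hbc' true true false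
          have h' := congrArg (fun n : ℕ => (n : ℝ)) h
          push_cast at h'
          linear_combination h'
        · simp only [fibVec3, exitVec, thR, nAdm, kInv, Pi.mul_apply, Matrix.cons_val]
          have h := card_fib3_m_joint Z₁ u u' u'' Z a Z' a' Z'' a'' a₁ ω hm hm' hm'' hbc' false true false
          have h' := congrArg (fun n : ℕ => (n : ℝ)) h
          push_cast at h'
          linear_combination h'
        · simp only [fibVec3, exitVec, thR, nAdm, kInv, Pi.mul_apply, Matrix.cons_val]
          have h := card_fib3_m_joint Z₁ u u' u'' Z a Z' a' Z'' a'' a₁ ω hm hm' hm'' hbc' true false false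
          have h' := congrArg (fun n : ℕ => (n : ℝ)) h
          push_cast at h'
          linear_combination h'
        · simp only [fibVec3, exitVec, thR, nAdm, kInv, Pi.mul_apply, Matrix.cons_val]
          have h := card_fib3_m_joint Z₁ u u' u'' Z a Z' a' Z'' a'' a₁ ω hm hm' hm'' hbc' true true true
          have h' := congrArg (fun n : ℕ => (n : ℝ)) h
          push_cast at h'
          linear_combination h'
        · simp only [fibVec3, exitVec, thR, nAdm, kInv, Pi.mul_apply, Matrix.cons_val]
          have h := card_fib3_m_joint Z₁ u u' u'' Z a Z' a' Z'' a'' a₁ ω hm hm' hm'' hbc' false true true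
          have h' := congrArg (fun n : ℕ => (n : ℝ)) h
          push_cast at h'
          linear_combination h'
        · simp only [fibVec3, exitVec, thR, nAdm, kInv, Pi.mul_apply, Matrix.cons_val]
          have h := card_fib3_m_joint Z₁ u u' u'' Z a Z' a' Z'' a'' a₁ ω hm hm' hm'' hbc' true false true
          have h' := congrArg (fun n : ℕ => (n : ℝ)) h
          push_cast at h'
          linear_combination h'
      · rw [if_neg hbc']
        simp only [thR_exitVec]
        refine vec6_ext _ _ ?_ ?_ ?_ ?_ ?_ ?_
        · simp only [fibVec3, exitVec, nVec, Pi.mul_apply, Matrix.cons_val]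
          rw [card_fib3_m_s_s Z₁ u u' u'' Z a Z' a' Z'' a'' a₁ ω hm hm' hm'' hbc' true true false]
          push_cast
          ring
        · simp only [fibVec3, exitVec, nVec, Pi.mul_apply, Matrix.cons_val]
          rw [card_fib3_m_s_s Z₁ u u' u'' Z a Z' a' Z'' a'' a₁ ω hm hm' hm'' hbc' false true false]
          push_cast
          ring
        · simp only [fibVec3, exitVec, nVec, Pi.mul_apply, Matrix.cons_val]
          rw [card_fib3_m_s_s Z₁ u u' u'' Z a Z' a' Z'' a'' a₁ ω hm hm' hm'' hbc' true false false]
          push_cast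
          ring
        · simp only [fibVec3, exitVec, nVec, Pi.mul_apply, Matrix.cons_val]
          rw [card_fib3_m_s_s Z₁ u u' u'' Z a Z' a' Z'' a'' a₁ ω hm hm' hm'' hbc' true true true]
          push_cast
          ring
        · simp only [fibVec3, exitVec, nVec, Pi.mul_apply, Matrix.cons_val]
          rw [card_fib3_m_s_s Z₁ u u' u'' Z a Z' a' Z'' a'' a₁ ω hm hm' hm'' hbc' false true true]
          push_cast
          ring
        · simp only [fibVec3, exitVec, nVec, Pi.mul_apply, Matrix.cons_val]
          rw [card_fib3_m_s_s Z₁ u u' u'' Z a Z' a' Z'' a'' a₁ ω hm hm' hm'' hbc' true false true]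
          push_cast
          ring

end TwoExit

end ZoneZ

end PercRepro
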